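import Summits.BirchSwinnertonDyer.BirchSwinnertonDyer.Theorems.Rank2ObservatoryConductorCert
import Summits.BirchSwinnertonDyer.BirchSwinnertonDyer.Theorems.Rank2ObservatoryRootNumberCert3
import HarnessLib

/-!
# BSD rank ≥ 2 observatory (`b2b-bsdr2`): CONDUCTOR certificates read off the root-number
# certificates WITH THE PLACE `3`, modulo the tree's named facts on conductor exponents

HONEST FRAMING: per-curve certified theorems and census instruments; no claim on BSD in rank ≥ 2.

The additive-at-`3` companion of `Rank2ObservatoryConductorCert`.  A checking certificate
`c : RNCert3` (`Rank2ObservatoryRootNumberCert3`) certifies `|Δ| = 2^{k2} 3^{j} ∏ pᵉ`, the exact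
`3`-adic valuations of `Δ, c₄, c₆`, and the reduction type at every bad prime `p ≥ 5` (multiplicative,
or additive by exact valuations; kind `3`: `c₄ = 0`).  If the equation is TAME AT `2` (`2 ∤ Δ` or
`2 ∤ c₄`, `RNCert3.tame`) every conductor exponent away from `3` is determined by the reduction type
(`0, 1, 2`), and AT `3` it is read from the `v(N)` column of Rizzo's Table II evaluated in the kernel
(`condExp3OfInt`, = `Rizzo.condExpOfInvariants` by `condExpOfInvariants_intCast`) GIVEN the named fact
`WeierstrassCurve.conductorExponent_eq_tableConductorExponentThree` (`RootNumberTableThree`; Tate's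
algorithm at `3` is not run in the tree).  So the conductor is the explicit number
`RNCert3.conductor W₀ c = 2^{[2 ∣ Δ]} · 3^{f₃} · ∏ p^{1 or 2}`.

Main result: `conductorNorm_eq_conductor3` — `(W₀ ⊗ ℚ).conductorNorm ℤ = c.conductor W₀` GIVEN, as
hypotheses BY NAME, the five named facts on conductor exponents of
`Literature.NumberTheory.DiophantineGeometry.Conductor` (as in `conductorNorm_eq_conductor`) AND the
Table II conductor-exponent fact at `3` (`h3`).  Used by `Rank2ObservatoryRank3ConductorCensus3` to
discharge `hN : conductorNorm ℤ = N` for the `1116` rank-3 census rows additive at `3` and tame at `2`.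

References: Silverman *ATAEC* IV.10 [Silverman1994]; *AEC* VII.1, VII.5, C.16 [SilvermanAEC2009];
Rizzo 2003 Table II [Rizzo2003].
-/

set_option linter.dupNamespace false
set_option autoImplicit false

noncomputable section

open IsDedekindDomain Rat.HeightOneSpectrum WeierstrassCurve Literature.NumberTheory.EllipticCurves

namespace Summit.BirchSwinnertonDyer.BirchSwinnertonDyer.Rank2Observatory.RootNumber

/-! ### The conductor read off a certificate with the place `3` -/

/-- Tameness at `2`, read off the certificate: `2 ∤ Δ` (`k2 = 0`) or `2 ∤ c₄` (`k4 = 0`, `c₄ ≠ 0`).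
[cite: SilvermanAEC2009, VII.5 Prop. 5.1] -/
def RNCert3.tame (W₀ : WeierstrassCurve ℤ) (c : RNCert3) : Bool :=
  decide (c.k2 = 0) || (decide (c.k4 = 0) && decide (W₀.c₄ ≠ 0))

/-- The conductor exponent certified by an entry: `condExp` for kinds `0, 1, 2`; `2` for kind `3`
(additive, `p ≥ 5`). [cite: Silverman1994, IV.10.2] -/
def OddEntry.condExp3 (E : OddEntry) : ℕ :=
  if E.kind = 3 then 2 else E.condExp

/-- The certified conductor `2^{[k2 ≠ 0]} · 3^{f₃} · ∏ p ^ condExp3`, `f₃` = Table II's `v(N)` at the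
integer invariants. [cite: Rizzo2003, Table II (p. 4), column v(N)] -/
def RNCert3.conductor (W₀ : WeierstrassCurve ℤ) (c : RNCert3) : ℕ :=
  (if c.k2 = 0 then 1 else 2) * 3 ^ condExp3OfInt W₀.c₄ W₀.c₆ W₀.Δ c.j4 c.j6 c.j *
    (c.odd.map fun E => E.p ^ E.condExp3).prod

section IntModel

variable {W₀ : WeierstrassCurve ℤ} {c : RNCert3}

/-- The odd part of the certified conductor is non-zero. [folklore] -/
theorem prod_condExp3_ne_zero (hc : c.check W₀ = true) :
    (c.odd.map fun E => E.p ^ E.condExp3).prod ≠ 0 := by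
  obtain ⟨-, -, -, -, -, -, -, hall, -⟩ := RNCert3.check_spec hc
  rw [Ne, List.prod_eq_zero_iff, List.mem_map]
  rintro ⟨E, hE, h0⟩
  exact pow_ne_zero _ (OddEntry.check3_spec (hall E hE)).1.ne_zero h0

/-- The certified conductor is non-zero. [folklore] -/
theorem conductor3_ne_zero (hc : c.check W₀ = true) : c.conductor W₀ ≠ 0 := by
  have hne := prod_condExp3_ne_zero hc
  unfold RNCert3.conductor
  refine mul_ne_zero (mul_ne_zero ?_ (pow_ne_zero _ (by decide))) hne
  split_ifs <;> decide

/-- **The conductor exponent at a place, from the certificate**: `f_v` equals the certified exponent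
at `p = natGenerator v` — `[k2 ≠ 0]` at `2` (tame case), Table II's `v(N)` at `3` (named fact `h3`),
`condExp3` at a listed prime `≥ 5`, `0` elsewhere. [cite: Silverman1994, IV.10.2 and IV.10.4]
[cite: Rizzo2003, Table II (p. 4), column v(N)] -/
theorem conductorExponent_eq_of_check3 (hc : c.check W₀ = true) (ht : c.tame W₀ = true)
    (h0 : ∀ v : HeightOneSpectrum ℤ, conductorExponent_eq_zero_iff v (W₀.baseChange ℚ))
    (h1 : ∀ v : HeightOneSpectrum ℤ, conductorExponent_eq_one_iff v (W₀.baseChange ℚ))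
    (h2 : ∀ v : HeightOneSpectrum ℤ, two_le_conductorExponent_iff v (W₀.baseChange ℚ))
    (h5 : ∀ v : HeightOneSpectrum ℤ,
      conductorExponent_le_two_of_five_le_natGenerator (W₀.baseChange ℚ) v)
    (h3 : (W₀.baseChange ℚ).conductorExponent_eq_tableConductorExponentThree)
    (v : HeightOneSpectrum ℤ) :
    (W₀.baseChange ℚ).conductorExponent v =
      (if natGenerator v = 2 then (if c.k2 = 0 then 0 else 1) else 0) +
        (if natGenerator v = 3 then condExp3OfInt W₀.c₄ W₀.c₆ W₀.Δ c.j4 c.j6 c.j else 0) +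
        (c.odd.map fun E => if E.p = natGenerator v then E.condExp3 else 0).sum := by
  obtain ⟨hk2, hk4, -, hj, hj4, hj6, hnd, hall, hfac⟩ := RNCert3.check_spec hc
  haveI : (W₀.baseChange ℚ).IsElliptic :=
    WeierstrassCurve.isElliptic_baseChange_int _ (ne_zero_of_exactPow hk2)
  -- a listed prime divides `Δ`
  have hdvdΔ : ∀ {E : OddEntry}, E ∈ c.odd → (E.p : ℤ) ∣ W₀.Δ := fun {E} hE ↦ by
    have he : 1 ≤ E.e := (OddEntry.check3_spec (hall E hE)).2.2.2.1
    rw [Int.natCast_dvd, hfac]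
    exact dvd_mul_of_dvd_right (dvd_trans (dvd_pow_self _ (by omega))
      (List.dvd_prod (List.mem_map.mpr ⟨E, hE, rfl⟩))) _
  have e0 : (W₀.baseChange ℚ).conductorExponent v = 0 ↔ (W₀.baseChange ℚ).HasGoodReductionAt v :=
    h0 v
  have e1 : (W₀.baseChange ℚ).conductorExponent v = 1 ↔
      (W₀.baseChange ℚ).HasMultiplicativeReductionAt v := h1 v
  have e2 : 2 ≤ (W₀.baseChange ℚ).conductorExponent v ↔
      (W₀.baseChange ℚ).HasAdditiveReductionAt v := h2 v
  have e5 : 5 ≤ natGenerator v → (W₀.baseChange ℚ).conductorExponent v ≤ 2 := h5 v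
  have hp : (natGenerator v).Prime := prime_natGenerator v
  simp only [RNCert3.tame, Bool.or_eq_true, Bool.and_eq_true, decide_eq_true_eq] at ht
  by_cases hv2 : natGenerator v = 2
  · -- the place of `2`: no listed entry has prime `2`
    have hsum : (c.odd.map fun E => if E.p = natGenerator v then E.condExp3 else 0).sum = 0 :=
      sum_ite_eq_zero _ _ _ fun E hE ↦ hv2 ▸ (OddEntry.check3_spec (hall E hE)).2.1
    rw [hsum, add_zero, if_pos hv2, if_neg (show natGenerator v ≠ 3 by rw [hv2]; decide), add_zero]
    by_cases hk : c.k2 = 0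
    · rw [if_pos hk]
      refine e0.mpr (hasGoodReductionAt_of_not_dvd ?_)
      rw [hv2]
      have := (exactPow_spec hk2).2
      rw [hk, zero_add, pow_one] at this
      exact_mod_cast this
    · rw [if_neg hk]
      rcases ht with h | ⟨h4, hc0⟩
      · exact absurd h hk
      have hc4 : ¬ (2 : ℤ) ∣ W₀.c₄ := by
        have := (exactPow_spec (hk4.resolve_left hc0)).2
        rw [h4, zero_add, pow_one] at this
        exact_mod_cast this
      have hΔ : (2 : ℤ) ∣ W₀.Δ :=
        dvd_trans (by exact_mod_cast dvd_pow_self (2 : ℤ) hk) (exactPow_spec hk2).1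
      exact e1.mpr (hasMultiplicativeReductionAt_of_dvd_of_not_dvd (by rw [hv2]; exact_mod_cast hΔ)
        (by rw [hv2]; exact_mod_cast hc4))
  by_cases hv3 : natGenerator v = 3
  · -- the place of `3`: Table II's `v(N)` column, by the named fact `h3`
    have hsum : (c.odd.map fun E => if E.p = natGenerator v then E.condExp3 else 0).sum = 0 :=
      sum_ite_eq_zero _ _ _ fun E hE ↦ hv3 ▸ (OddEntry.check3_spec (hall E hE)).2.2.1
    rw [hsum, add_zero, if_neg hv2, zero_add, if_pos hv3,
      h3 v (by rw [ringChar_quot_eq, hv3]), tableConductorExponentThree_def, baseChange_int_c₄,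
      baseChange_int_c₆, baseChange_int_Δ]
    exact condExpOfInvariants_intCast _ _ _ _ _ _ hj4 hj6 hj
  · rw [if_neg hv2, if_neg hv3, zero_add, zero_add]
    by_cases hmem : natGenerator v ∈ c.odd.map OddEntry.p
    · -- a listed prime `≥ 5`
      obtain ⟨E, hE, hEp⟩ := List.mem_map.mp hmem
      rw [← hEp, sum_ite_eq_of_nodup _ _ hnd E hE]
      obtain ⟨-, -, -, he, hk3, hne3⟩ := OddEntry.check3_spec (hall E hE)
      have hΔ : (natGenerator v : ℤ) ∣ W₀.Δ := hEp ▸ hdvdΔ hE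
      by_cases hK3 : E.kind = 3
      · rw [OddEntry.condExp3, if_pos hK3]
        obtain ⟨h5p, heΔ, hc40, hlt⟩ := hk3 hK3
        refine le_antisymm (e5 (hEp ▸ h5p)) (e2.mpr ?_)
        exact hasAdditiveReductionAt_of_dvd v he (hEp ▸ (exactPow_spec heΔ).1)
          (hEp ▸ (exactPow_spec heΔ).2) (Or.inl hlt) (by rw [hc40]; exact dvd_zero _)
      rw [OddEntry.condExp3, if_neg hK3]
      obtain ⟨-, -, -, hk0, hk1, hk2'⟩ := OddEntry.check_spec (hne3 hK3)
      by_cases hK0 : E.kind = 0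
      · rw [OddEntry.condExp, if_pos hK0]
        exact e1.mpr (hasMultiplicativeReductionAt_of_dvd_of_not_dvd hΔ (hEp ▸ (hk0 hK0).1))
      by_cases hK1 : E.kind = 1
      · rw [OddEntry.condExp, if_neg hK0, if_pos hK1]
        exact e1.mpr (hasMultiplicativeReductionAt_of_dvd_of_not_dvd hΔ (hEp ▸ (hk1 hK1).1))
      · rw [OddEntry.condExp, if_neg hK0, if_neg hK1]
        obtain ⟨h5p, heΔ, hc₄, htc, hmin⟩ := hk2' hK0 hK1
        refine le_antisymm (e5 (hEp ▸ h5p)) (e2.mpr ?_)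
        refine hasAdditiveReductionAt_of_dvd v he (hEp ▸ (exactPow_spec heΔ).1)
          (hEp ▸ (exactPow_spec heΔ).2) ?_ (hEp ▸ hc₄)
        rcases hmin with h | h
        · exact Or.inl h
        · right
          rw [← hEp]
          exact fun h4 ↦ (exactPow_spec htc).2 (dvd_trans (pow_dvd_pow _ (by omega)) h4)
    · -- off the bad primes: good reduction
      rw [sum_ite_eq_zero _ _ _ fun E hE h ↦ hmem (List.mem_map.mpr ⟨E, hE, h⟩)]
      refine e0.mpr (hasGoodReductionAt_of_not_dvd fun hdvd ↦ ?_)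
      rcases List.mem_cons.mp (mem_of_prime_dvd3 hc hp hdvd) with h | h
      · exact hv2 h
      rcases List.mem_cons.mp h with h | h
      · exact hv3 h
      · exact hmem h

/-- **The conductor from a certificate with the place `3`** (tame at `2`), modulo the named facts:
`N (W₀ ⊗ ℚ) = c.conductor W₀`. [cite: Silverman1994, IV.10.2 and IV.10.4]
[cite: Rizzo2003, Table II (p. 4), column v(N)] [cite: SilvermanAEC2009, C.16] -/
theorem conductorNorm_eq_conductor3 (hc : c.check W₀ = true) (ht : c.tame W₀ = true)
    (h0 : ∀ v : HeightOneSpectrum ℤ, conductorExponent_eq_zero_iff v (W₀.baseChange ℚ))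
    (h1 : ∀ v : HeightOneSpectrum ℤ, conductorExponent_eq_one_iff v (W₀.baseChange ℚ))
    (h2 : ∀ v : HeightOneSpectrum ℤ, two_le_conductorExponent_iff v (W₀.baseChange ℚ))
    (h5 : ∀ v : HeightOneSpectrum ℤ,
      conductorExponent_le_two_of_five_le_natGenerator (W₀.baseChange ℚ) v)
    (hf : ∀ v : HeightOneSpectrum ℤ, factorization_conductorNorm (W₀.baseChange ℚ) v)
    (h3 : (W₀.baseChange ℚ).conductorExponent_eq_tableConductorExponentThree) :
    (W₀.baseChange ℚ).conductorNorm ℤ = c.conductor W₀ := by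
  obtain ⟨hk2, -, -, -, -, -, -, hall, -⟩ := RNCert3.check_spec hc
  haveI : (W₀.baseChange ℚ).IsElliptic :=
    WeierstrassCurve.isElliptic_baseChange_int _ (ne_zero_of_exactPow hk2)
  have hprime : ∀ E ∈ c.odd, E.p.Prime := fun E hE ↦ (OddEntry.check3_spec (hall E hE)).1
  refine Nat.eq_of_factorization_eq
    (conductorNorm_pos_holds (W₀.baseChange ℚ) : 0 < (W₀.baseChange ℚ).conductorNorm ℤ).ne'
    (conductor3_ne_zero hc) fun p ↦ ?_
  by_cases hp : p.Prime
  · have hfac : ((W₀.baseChange ℚ).conductorNorm ℤ).factorization (natGenerator (natPlace p)) =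
        (W₀.baseChange ℚ).conductorExponent (natPlace p) := hf (natPlace p)
    rw [natGenerator_natPlace hp] at hfac
    have h2ne : (if c.k2 = 0 then 1 else 2 : ℕ) ≠ 0 := by split_ifs <;> decide
    rw [hfac, conductorExponent_eq_of_check3 hc ht h0 h1 h2 h5 h3 (natPlace p),
      natGenerator_natPlace hp, RNCert3.conductor,
      Nat.factorization_mul (mul_ne_zero h2ne (pow_ne_zero _ (by decide))) (prod_condExp3_ne_zero hc),
      Nat.factorization_mul h2ne (pow_ne_zero _ (by decide)), Finsupp.add_apply, Finsupp.add_apply,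
      factorization_prod_map_pow OddEntry.condExp3 c.odd hprime p, Nat.factorization_pow,
      Finsupp.smul_apply, Nat.prime_three.factorization, Finsupp.single_apply, smul_eq_mul]
    congr 1
    congr 1
    · by_cases hp2 : p = 2
      · subst hp2
        by_cases hk : c.k2 = 0
        · rw [if_pos rfl, if_pos hk, if_pos hk, Nat.factorization_one, Finsupp.zero_apply]
        · rw [if_pos rfl, if_neg hk, if_neg hk, Nat.prime_two.factorization_self]
      · by_cases hk : c.k2 = 0
        · rw [if_neg hp2, if_pos hk, Nat.factorization_one, Finsupp.zero_apply]
        · rw [if_neg hp2, if_neg hk, Nat.prime_two.factorization, Finsupp.single_apply,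
            if_neg (Ne.symm hp2)]
    · by_cases hp3 : p = 3
      · subst hp3; simp
      · rw [if_neg hp3, if_neg (Ne.symm hp3), mul_zero]
  · rw [Nat.factorization_eq_zero_of_not_prime _ hp, Nat.factorization_eq_zero_of_not_prime _ hp]

end IntModel

/-- Self-test (kernel): `27747c1 = [0,0,1,−327,2286]` (`N = 27747 = 3² · 3083`; additive at `3`,
Table II row `(2,3,≥6)`: `v(N) = 2`; good at `2`): tame, conductor `27747`.
[cite: CremonaAlgorithms1997, Tables] -/
example : RNCert3.tame ⟨0, 0, 1, -327, 2286⟩ ⟨0, 4, 3, 8, 2, 3, [⟨3083, 55, 1, 1, 1569⟩]⟩ = true ∧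
    RNCert3.conductor ⟨0, 0, 1, -327, 2286⟩ ⟨0, 4, 3, 8, 2, 3, [⟨3083, 55, 1, 1, 1569⟩]⟩ = 27747 := by
  constructor <;> decide +kernel

end Summit.BirchSwinnertonDyer.BirchSwinnertonDyer.Rank2Observatory.RootNumber

end
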